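import Summits.BirchSwinnertonDyer.BirchSwinnertonDyer.Theorems.Rank2Observatory2DescKillSig3Core
import HarnessLib

/-!
# KERNEL-2DESC — the SIGNATURE kill certificate `sig12uCheck` at an odd prime with ONE `ℤ_q`-root and an
# UNRAMIFIED quadratic place (rank-2 observatory, cert-1 gen 38; TIER 2u of `census/sigkill/SIGKILL-SPEC.md` §5)

HONEST FRAMING: per-curve certified theorems and census instruments; no claim on BSD in rank ≥ 2.
PARTITION: none — rank ≥ 2 data (N3); no r ≤ 1 cell claimed.

Companion of `Rank2Observatory2DescKillSig3` (three roots).  Here the field cubic factors over `ℤ_q` as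
`g = (X − ε)·h`, `h = (X − r₁)² − D'` with `D' = q^{2k_d}·δ`, `δ` a non-residue unit: the quadratic place of
`K = ℚ(α)` over `q` is UNRAMIFIED with ring of integers `ℤ_q[η']`, `η' = (α − r₁)/q^{k_d}`, `η'² = δ`.  A zero
`v = (r₀, r₁, r₂, n)` of `killQ` gives `z·r² = w₀ − n²·T` in `ℤ[α]`; evaluating at `α ↦ ε` (integers mod `q^N`,
`root_rel`) and at `α ↦ r₁ + q^{k_d}η'` (PAIRS `C + Bη'` mod `q^N`, `quad_rel`, the substitution identity
`ev2_mul3`) gives one congruence in `ℤ/q^N` and one in pairs.  Square classes at the quadratic place are read off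
the pair valuation and the Euler bit of the NORM `C² − δB²` (a unit of `ℤ_{q²}` is a square iff its norm is a
square mod `q`); the pair version `core2` of the core lemma, the anisotropy of the norm form (`nm_unit`) and the
index bound `v(r(ε)) = 0 ∨ v_𝔭(r(η)) ≤ k_d` for a `q`-primitive `r` (`index2`) replace the three-root tools; the
disc walk `walk2` sweeps the `q` digits of a level while the quadratic centre is undecided (depth `≤ v_q(E_B) + 1`,
so `≤ q·(k + 2)` nodes) and otherwise reads the two decided signatures (`outMis` of the three-root file for the
root place, `quadMis` here).  `sig12uCheck_sound` has the signature of `killCheck_sound`;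
`killValidAt_of_sig12uCheck` drops into the validity-form rows like `killValidAt_of_sig3Check`.
Integers only; no `p`-adics, no `native_decide`.

Structure: `sig12uCheck` COMPUTES the local data (cofactor `h₁, h₀`, `r₁ = −h₁/2`, `D' = q^{2k_d}δ`, root data
`ρ = (e₁, s₁, u₁) = rootData`, pair data `ev2 z = q^{s₂}·U`, centre `ev2 (0, t₁, t₂) = (E_C, q^k B_u)`) and
`sig12uCore` DECIDES the conditions on it; `sig12uCore_sound` proves that no `q`-primitive zero of `killQ` exists
from the conditions plus the defining congruences of the data (so the wrapper `sig12uCheck_sound` is `rfl`-fed):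
coefficient identities in `ZMod (q^N)` ⟹ `g(ε) ≡ 0` (`root_rel`) and the pair relation (`quad_rel`); then
`q ∤ n` ⟹ the walk (`kill_scaled`, `walk2_sound`: `outMis_sound` / `quadMis_sound` / digit children);
`q ∣ n` ⟹ by `index2` either the root value is a unit (`val_bound`, `D = 0`) or the pair value is not divisible
by `q^{k_d+1}` (`val_bound2`); in both sub-cases either `n²` out-divides the constant — the RAT-like signature,
refused (`rat2`) — or `w₀ = q^{2τ}w₀'`, `n = q^τn'` and the walk runs at offset `K = 2τ` (`kill_scaled`).
SPLIT (gate lint «Theorems files ≤ 400 lines»): this is part 1 of 3 — `…Sig12Defs` (pairs, `ev2`, the substitution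
identities, `quadDecided` / `quadSigOf` / `quadMis` / `walk2`, `sig12uCore`, `sig12uCheck`; imports the tier-1 part 1
`Rank2Observatory2DescKillSig3Core`: `splitPow`, `eulerBit`, `rootData`, `unitOK`, `outMis`), part 2 `…Sig12Core` (the pair core
lemma `core2`, `quadMis_sound`, `walk2_sound`, `kill_scaled`; imports the tier-1 part 2 `Rank2Observatory2DescKillSig3` for
`core`, `val_bound`, `root_rel`, `outMis_sound`, `digit_exists`), part 3 `…Sig12` (`index2`, `val_bound2`, `rat2`, `quad_rel`,
`sig12uCore_sound`, `sig12uCheck_sound`, `killValidAt_of_sig12uCheck`). Lands after the tier-1 files.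
[cite: Cassels1991LecturesEllipticCurves, §15] [cite: CremonaAlgorithms1997, §3.6]
-/

-- single-conjunct summit: `Summit.BirchSwinnertonDyer.BirchSwinnertonDyer.…` repeats the name by design
set_option linter.dupNamespace false

namespace Summit.BirchSwinnertonDyer.BirchSwinnertonDyer.Rank2Observatory.TwoDescKill

/-! ### Pairs `C + B·η'` with `η'² = δ` -/

/-- Norm form `C² − δB²` of the pair `(C, B) = C + Bη'`. [folklore] -/
def nm (dl C B : ℤ) : ℤ := C * C - dl * B * B

/-- Product of pairs: `(C + Bη')(C' + B'η') = (CC' + δBB') + (CB' + C'B)η'`. [folklore] -/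
def pmul (dl : ℤ) (x y : ℤ × ℤ) : ℤ × ℤ := (x.1 * y.1 + dl * x.2 * y.2, x.1 * y.2 + x.2 * y.1)

/-- The norm form is multiplicative (Brahmagupta). [folklore] -/
theorem nm_pmul (dl : ℤ) (x y : ℤ × ℤ) :
    nm dl (pmul dl x y).1 (pmul dl x y).2 = nm dl x.1 x.2 * nm dl y.1 y.2 := by
  simp only [nm, pmul]; ring

section Ring
variable {R : Type*} [CommRing R]

/-- Evaluation of `w₀ + w₁X + w₂X²` at `X = r₁ + m·Y` reduced modulo `Y² = δ`: the pair `(C, B) = C + B·Y`. [folklore] -/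
def ev2 (r₁ m dl : R) (w : R × R × R) : R × R :=
  (w.1 + w.2.1 * r₁ + w.2.2 * (r₁ * r₁ + m * m * dl), m * (w.2.1 + 2 * r₁ * w.2.2))

/-- Generic pair product over a ring (same formula as `pmul`). [folklore] -/
def pmulR (dl : R) (x y : R × R) : R × R := (x.1 * y.1 + dl * x.2 * y.2, x.1 * y.2 + x.2 * y.1)

/-- **Substitution identity.** When `g = X³ + aX² + bX + c = (X − ε)·((X − r₁)² − m²δ)` coefficientwise,
reduction modulo `g` followed by `X ↦ r₁ + mY`, `Y² = δ` is multiplicative: `ev2 (mul3 u v) = ev2 u · ev2 v`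
(a polynomial identity; the map `R[X]/(g) → R[Y]/(Y² − δ)` is a ring map because `g ↦ 0`). [folklore] -/
theorem ev2_mul3 (ε r₁ m dl : R) (u v : R × R × R) :
    ev2 r₁ m dl (mul3 (-ε - 2 * r₁) (r₁ * r₁ - m * m * dl + 2 * ε * r₁) (-(ε * (r₁ * r₁ - m * m * dl))) u v) =
      pmulR dl (ev2 r₁ m dl u) (ev2 r₁ m dl v) := by
  simp only [ev2, mul3, pmulR, Prod.mk.injEq]
  constructor <;> ring

/-- The same for `zsq = z·r²`. [folklore] -/
theorem ev2_zsq (ε r₁ m dl : R) (z r : R × R × R) :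
    ev2 r₁ m dl (zsq (-ε - 2 * r₁) (r₁ * r₁ - m * m * dl + 2 * ε * r₁) (-(ε * (r₁ * r₁ - m * m * dl))) z r) =
      pmulR dl (ev2 r₁ m dl z) (pmulR dl (ev2 r₁ m dl r) (ev2 r₁ m dl r)) := by
  simp only [zsq, ev2_mul3]

end Ring

/-! ### The checker -/

/-- The quadratic centre is DECIDED on the disc `c + q^j ℤ_q`: `v_q(c − E_C) < j`, or `j ≥ k + 1`. [folklore] -/
def quadDecided (q k : ℕ) (EC c : ℤ) (j : ℕ) : Bool :=
  !decide ((c - EC) % ((q ^ j : ℕ) : ℤ) = 0) || decide (k + 1 ≤ j)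

/-- The decided signature `(m, bit)` of `(y − E_C) − E_B η'` for `y ≡ c (mod q^j)` (`k = v_q(E_B)`, `Bp ≡ E_B/q^k`):
`m = min(v_q(y − E_C), k)`; `bit` = Euler bit of the norm of the unit part (`true` when `v_q(y − E_C) < k`). [folklore] -/
def quadSigOf (q : ℕ) (dl : ℤ) (k : ℕ) (Bp EC c : ℤ) (j : ℕ) : ℕ × Bool :=
  let d := c - EC
  let sp := splitPow q j d
  if ¬ d % ((q ^ j : ℕ) : ℤ) = 0 ∧ sp.1 < k then (sp.1, true)
  else (k, eulerBit q (nm dl ((d / ((q ^ k : ℕ) : ℤ)) % (q : ℤ)) Bp))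

/-- Decided AND mismatching the class signature `(s₂, ℓ₂)` at the quadratic place. [folklore] -/
def quadMis (q : ℕ) (dl : ℤ) (k : ℕ) (Bp EC : ℤ) (s₂ : ℕ) (ℓ₂ : Bool) (c : ℤ) (j : ℕ) : Bool :=
  let d := c - EC
  let sg := quadSigOf q dl k Bp EC c j
  quadDecided q k EC c j &&
    (decide (d % ((q ^ j : ℕ) : ℤ) = 0) || !decide ((splitPow q j d).2 % (q : ℤ) = 0)) &&
    (!decide ((s₂ + sg.1) % 2 = 0) || !decide (sg.2 = ℓ₂))

/-- The disc walk of TIER 2u: a node (disc `c + q^j ℤ_q` of `y`) is certified when the precision guard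
`j + B < N` holds and either a decided place mismatches, or the quadratic centre is still undecided and all
`q` children are certified. [folklore] -/
def walk2 (q : ℕ) (ρ : ℤ × ℕ × ℤ) (dl : ℤ) (k : ℕ) (Bp EC : ℤ) (s₂ : ℕ) (ℓ₂ : Bool) (B N : ℕ) :
    ℕ → ℤ → ℕ → Bool
  | 0, c, j => decide (j + B < N) && (outMis q c j ρ || quadMis q dl k Bp EC s₂ ℓ₂ c j)
  | f + 1, c, j => decide (j + B < N) &&
      (outMis q c j ρ || quadMis q dl k Bp EC s₂ ℓ₂ c j ||
        (!quadDecided q k EC c j &&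
          (List.range q).all fun d => walk2 q ρ dl k Bp EC s₂ ℓ₂ B N f (c + (d : ℤ) * ((q ^ j : ℕ) : ℤ)) (j + 1)))

/-- The decided CONDITIONS of the TIER-2u certificate on precomputed data (see `sig12uCheck` for the data):
`q` odd; `g(ε) ≡ 0` (as `c + ε·h₀ ≡ 0`); `2r₁ ≡ −h₁`; `D' = q^{2k_d}·δ` with `δ` a non-residue unit; `h(ε)` a
unit; `u₁` a unit; `(Z_C, Z_B) = q^{s₂}·(U_C, U_B)` with `nm U` a unit; `E_B = q^k·B_u`, `B_u` a unit; the class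
is not RAT-like (`s₁ ≡ s₂ (mod 2)` and `ℓ₂ = true` is refused); the disc walk from `(0, 0)` with guard offset
`max(s₁, s₂) + 2k_d`. [folklore] -/
def sig12uCore (q N : ℕ) (c ε h₁ h₀ r₁ Dp dl : ℤ) (kd : ℕ) (ρ : ℤ × ℕ × ℤ) (ZC ZB : ℤ) (s₂ : ℕ)
    (UC UB EC EB : ℤ) (k : ℕ) (Bu : ℤ) : Bool :=
  let M : ℤ := ((q ^ N : ℕ) : ℤ)
  let nU := nm dl UC UB
  decide (q % 2 = 1) &&
  decide ((c + ε * h₀) % M = 0) && decide ((2 * r₁ + h₁) % M = 0) &&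
  decide (Dp = ((q ^ (2 * kd) : ℕ) : ℤ) * dl) && unitOK q dl && !eulerBit q dl &&
  unitOK q ((ε - r₁) ^ 2 - Dp) &&
  unitOK q ρ.2.2 &&
  decide (ZC = ((q ^ s₂ : ℕ) : ℤ) * UC) && decide (ZB = ((q ^ s₂ : ℕ) : ℤ) * UB) && unitOK q nU &&
  decide (EB = ((q ^ k : ℕ) : ℤ) * Bu) && unitOK q Bu &&
  !(decide (ρ.2.1 % 2 = s₂ % 2) && eulerBit q nU) &&
  walk2 q ρ dl k (Bu % (q : ℤ)) EC s₂ (eulerBit q nU) (max ρ.2.1 s₂ + 2 * kd) N N 0 0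

/-- **The TIER-2u certificate check** at the prime `q` for the class `z`, `θ`-coordinates `(t₁, t₂)`, field cubic
`X³ + aX² + bX + c`, precision `N` and the `ℤ_q`-root `ε` (mod `q^N`): computes the cofactor data
`h₁, h₀, r₁ = −h₁/2, D' = r₁² − h₀ = q^{2k_d}·δ`, the root data `ρ = (e₁, s₁, u₁)` (`rootData`), the pair data
`Z₂ = ev2 z = q^{s₂}·(U_C, U_B)`, the centre `E = ev2 (0, t₁, t₂) = (E_C, q^k·B_u)`, and runs `sig12uCore`.
[folklore] -/
def sig12uCheck (q : ℕ) (a b c : ℤ) (z : ℤ × ℤ × ℤ) (t₁ t₂ : ℤ) (N : ℕ) (ε : ℤ) : Bool :=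
  let M : ℤ := ((q ^ N : ℕ) : ℤ)
  let h₁ := (a + ε) % M
  let h₀ := (b + ε * h₁) % M
  let r₁ := (-h₁ * ((M + 1) / 2)) % M
  let Dp := (r₁ * r₁ - h₀) % M
  let sd := splitPow q N Dp
  let kd := sd.1 / 2
  let m : ℤ := ((q ^ kd : ℕ) : ℤ)
  let ρ := rootData q N z t₁ t₂ ε
  let ZC := (ev2 r₁ m sd.2 z).1 % M
  let ZB := (ev2 r₁ m sd.2 z).2 % M
  let sC := (splitPow q N ZC).1
  let sB := (splitPow q N ZB).1
  let s₂ := if ZC = 0 then sB else if ZB = 0 then sC else min sC sB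
  let UC := ZC / ((q ^ s₂ : ℕ) : ℤ)
  let UB := ZB / ((q ^ s₂ : ℕ) : ℤ)
  let EC := (ev2 r₁ m sd.2 ((0 : ℤ), t₁, t₂)).1 % M
  let EB := (ev2 r₁ m sd.2 ((0 : ℤ), t₁, t₂)).2 % M
  let sE := splitPow q N EB
  sig12uCore q N c ε h₁ h₀ r₁ Dp sd.2 kd ρ ZC ZB s₂ UC UB EC EB sE.1 sE.2

end Summit.BirchSwinnertonDyer.BirchSwinnertonDyer.Rank2Observatory.TwoDescKill
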